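import Summits.KontsevichZagierPeriods.Zeta5Search.Certificates.VIMLevel2NKEnd
import HarnessLib

/-!
# ζ(5) search — brown9 LEVEL 2: the `n`-shift relation (R-NK) of the inner double sum `R(n,k₃)` (replayed certificate) (cell `pub-zeta5`, certifier `cert-1`)

HONEST FRAMING: systematic search; no irrationality claim unless certified.

Conclusion of the replay of the ttrl2 lane's R-NK certificate (`run/shared/lean/ttrl/zeta5-calc/brown9/VIM.md` §7,
`r1c/R_NK.json`): for the inner double sum `R(n,x) = Σ_{k ≤ n} h·T(n;3n−x−k,2n−k)` of the "vanishing in the middle"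
leading coefficient (fam-brown9) and every rational `x = k₃`,
  `e10(n,x)·R(n+1,x) + e00(n,x)·R(n,x) + e01(n,x)·R(n,x+1) = 0`   (`n ≥ 3`; `e.. = 5η..` of the lane),
i.e. `(n+1)³(x−2n−2)²(x−2n−1)²·R(n+1,x) + 5η₀₀·R(n,x) + 5η₀₁·R(n,x+1) = 0`.
Steps: (1) the ENDPOINT identity at `k = n` (`NK_endpoint`): the terms `s(n+1,x,n) + s(n+1,x,n+1)`, `s(n,x,n)`,
`s(n,x+1,n)` and the certificate value `g(n)` are closed forms in `C(2n−x+j, ·)` (since `T(N;p,N) = C(p,N)` and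
`T(N;p,N+1) = (N+1)C(p,N) − N·C(p−1,N)`), and their combination vanishes by a kernel-checked polynomial identity in
`(n,x)` (`endpoly`, one Kronecker evaluation; the lane's `endpoint_R.json` states the same fact); (2) summing the
termwise identity of `Certificates/VIMLevel2NKTerm.lean` over `k < n` (telescope, `g(0) = 0`) and adding the endpoint
gives the relation for `x < 0` (`R_rel_NK_neg`); (3) the left-hand side is a polynomial function of `x`
(`polyRep_*`, generic `polyRepPeval`), so it vanishes for every rational `x` (`R_rel_NK`). No named facts.
-/

noncomputable section

namespace Summit.KontsevichZagierPeriods.Zeta5Search.Certificates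

namespace VIMInner

open Finset PolyReflect Polynomial
open Lean.Grind.CommRing (Expr)

namespace NK

/-! ### The endpoint identity at `k = n` -/


set_option maxHeartbeats 4000000 in
set_option maxRecDepth 100000 in
/-- **Endpoint** (`n = m+3`, `x < 0`): `e10·(s(n+1,x,n) + s(n+1,x,n+1)) + e00·s(n,x,n) + e01·s(n,x+1,n) + g(n) = 0`. -/
theorem NK_endpoint (m : ℕ) (x : ℚ) (hx : x < 0) :
    e10 ((m + 3 : ℕ) : ℚ) x * (sR (m + 3 + 1) x (m + 3) + sR (m + 3 + 1) x (m + 3 + 1))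
      + e00 ((m + 3 : ℕ) : ℚ) x * sR (m + 3) x (m + 3) + e01 ((m + 3 : ℕ) : ℚ) x * sR (m + 3) (x + 1) (m + 3)
      + gNK (m + 3) x (m + 3) = 0 := by
  have hm0 : (0 : ℚ) ≤ m := Nat.cast_nonneg m
  have hAdef : pOf (m + 3) x (m + 3) = 2 * ((m : ℚ) + 3) - x := by unfold pOf; push_cast; ring
  -- nonvanishing
  have nA : 2 * ((m : ℚ) + 3) - x ≠ 0 := ne_of_gt (by linarith)
  have nA1 : 2 * ((m : ℚ) + 3) - x - m - 1 ≠ 0 := ne_of_gt (by linarith)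
  have nA2 : 2 * ((m : ℚ) + 3) - x - m - 2 ≠ 0 := ne_of_gt (by linarith)
  have hF := FN_ne_zero m
  have hf3 : (((m + 3).factorial : ℕ) : ℚ) ≠ 0 := by positivity
  have hf4 : (((m + 4).factorial : ℕ) : ℚ) ≠ 0 := by positivity
  -- arguments of the four summands
  have p1 : pOf (m + 3 + 1) x (m + 3) = pOf (m + 3) x (m + 3) + 3 := pOf_nsucc (m + 3) x (m + 3)
  have p2 : pOf (m + 3 + 1) x (m + 3 + 1) = pOf (m + 3) x (m + 3) + 2 := by unfold pOf; push_cast; ring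
  have p3 : pOf (m + 3) (x + 1) (m + 3) = pOf (m + 3) x (m + 3) - 1 := pOf_xsucc (m + 3) x (m + 3)
  have q1 : qOf (m + 3 + 1) (m + 3) = ((m + 3 + 1 : ℕ) : ℚ) + 1 := by unfold qOf; push_cast; ring
  have q2 : qOf (m + 3 + 1) (m + 3 + 1) = ((m + 3 + 1 : ℕ) : ℚ) := by unfold qOf; push_cast; ring
  have q0 : qOf (m + 3) (m + 3) = ((m + 3 : ℕ) : ℚ) := by unfold qOf; push_cast; ring
  -- closed forms of the summands
  have hs1 : sR (m + 3 + 1) x (m + 3) = ((-1 : ℚ) ^ (m + 3)) * ((m : ℚ) + 4) * bp (m + 4) (2 * ((m : ℚ) + 3) - x + 3) * (((((m + 4 : ℕ)) : ℚ) + 1) * bp (m + 4) (2 * ((m : ℚ) + 3) - x + 3) - (((m + 4 : ℕ)) : ℚ) * bp (m + 4) (2 * ((m : ℚ) + 3) - x + 2)) := by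
    unfold sR hR
    rw [p1, q1, Nat.choose_succ_self_right, show m + 3 + 1 = m + 4 from rfl, T_q_succ (m + 4) (by omega), hAdef,
      show 2 * ((m : ℚ) + 3) - x + 3 - 1 = 2 * ((m : ℚ) + 3) - x + 2 by ring]
    push_cast; ring
  have hs2 : sR (m + 3 + 1) x (m + 3 + 1) = -((-1 : ℚ) ^ (m + 3)) * bp (m + 4) (2 * ((m : ℚ) + 3) - x + 2) * bp (m + 4) (2 * ((m : ℚ) + 3) - x + 2) := by
    unfold sR hR
    rw [p2, q2, Nat.choose_self, show m + 3 + 1 = m + 4 from rfl, T_q_self, hAdef]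
    push_cast; ring
  have hs0 : sR (m + 3) x (m + 3) = ((-1 : ℚ) ^ (m + 3)) * bp (m + 3) (2 * ((m : ℚ) + 3) - x) * bp (m + 3) (2 * ((m : ℚ) + 3) - x) := by
    unfold sR hR; rw [q0, T_q_self, Nat.choose_self, hAdef]; push_cast; ring
  have hs01 : sR (m + 3) (x + 1) (m + 3) = ((-1 : ℚ) ^ (m + 3)) * bp (m + 3) (2 * ((m : ℚ) + 3) - x - 1) * bp (m + 3) (2 * ((m : ℚ) + 3) - x - 1) := by
    unfold sR hR; rw [p3, q0, T_q_self, Nat.choose_self, hAdef]; push_cast; ring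
  -- the certificate value times its denominator
  have hg : (2 * ((m : ℚ) + 3) - x) * (2 * ((m : ℚ) + 3) - x - m - 1) ^ 2 * (2 * ((m : ℚ) + 3) - x - m - 2) * gNK (m + 3) x (m + 3)
      = ((-1 : ℚ) ^ (m + 3)) * bp (m + 3) (2 * ((m : ℚ) + 3) - x) * ((m : ℚ) + 3)
        * (PR0 ((m + 3 : ℕ) : ℚ) x ((m + 3 : ℕ) : ℚ) * bp (m + 3) (2 * ((m : ℚ) + 3) - x) + PR1 ((m + 3 : ℕ) : ℚ) x ((m + 3 : ℕ) : ℚ) * bp (m + 3) (2 * ((m : ℚ) + 3) - x + 1)) := by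
    have hden : den0 (m + 3) x (m + 3) = (2 * ((m : ℚ) + 3) - x) * (2 * ((m : ℚ) + 3) - x - m - 1) ^ 2 * (2 * ((m : ℚ) + 3) - x - m - 2) := by unfold den0; rw [hAdef]; push_cast; ring
    have hT1 : T (m + 3) (pOf (m + 3) x (m + 3) + 1) (qOf (m + 3) (m + 3)) = bp (m + 3) (2 * ((m : ℚ) + 3) - x + 1) := by
      rw [q0, T_q_self, hAdef]
    have hT0 : T (m + 3) (pOf (m + 3) x (m + 3)) (qOf (m + 3) (m + 3)) = bp (m + 3) (2 * ((m : ℚ) + 3) - x) := by rw [q0, T_q_self, hAdef]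
    unfold gNK hR
    rw [hT0, hT1, hden, Nat.choose_self, hAdef]
    field_simp
    push_cast; ring
  -- products of factorials and polynomial binomials in the common core `c = fallProd m (a−1)`
  have hFN : FN m = ((m : ℚ) + 4) * (((m + 3).factorial : ℕ) : ℚ) := by
    unfold FN; rw [show m + 4 = m + 3 + 1 from rfl, Nat.factorial_succ]; push_cast; ring
  have g3 : FN m * bp (m + 4) (2 * ((m : ℚ) + 3) - x + 3) = ((2 * ((m : ℚ) + 3) - x + 3) * (2 * ((m : ℚ) + 3) - x + 2) * (2 * ((m : ℚ) + 3) - x + 1) * (2 * ((m : ℚ) + 3) - x) * fallProd m (2 * ((m : ℚ) + 3) - x - 1)) := by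
    unfold FN bp
    rw [← mul_div_assoc, mul_div_cancel_left₀ _ hf4, fallProd_four_pred]
  have g2 : FN m * bp (m + 4) (2 * ((m : ℚ) + 3) - x + 2) = ((2 * ((m : ℚ) + 3) - x + 2) * (2 * ((m : ℚ) + 3) - x + 1) * (2 * ((m : ℚ) + 3) - x) * fallProd m (2 * ((m : ℚ) + 3) - x - 1) * (2 * ((m : ℚ) + 3) - x - 1 - m)) := by
    unfold FN bp
    rw [← mul_div_assoc, mul_div_cancel_left₀ _ hf4, show m + 4 = m + 3 + 1 from rfl, fallProd_succ_pred,
      show 2 * ((m : ℚ) + 3) - x + 2 - 1 = 2 * ((m : ℚ) + 3) - x + 1 by ring, fallProd_three_succ]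
    ring
  have ga : FN m * bp (m + 3) (2 * ((m : ℚ) + 3) - x) = (((m : ℚ) + 4) * ((2 * ((m : ℚ) + 3) - x) * fallProd m (2 * ((m : ℚ) + 3) - x - 1) * (2 * ((m : ℚ) + 3) - x - 1 - m) * (2 * ((m : ℚ) + 3) - x - 2 - m))) := by
    rw [hFN, mul_assoc]; unfold bp; rw [← mul_div_assoc, mul_div_cancel_left₀ _ hf3, fallProd_three_pred]; ring
  have gm : FN m * bp (m + 3) (2 * ((m : ℚ) + 3) - x - 1) = (((m : ℚ) + 4) * (fallProd m (2 * ((m : ℚ) + 3) - x - 1) * (2 * ((m : ℚ) + 3) - x - 1 - m) * (2 * ((m : ℚ) + 3) - x - 2 - m) * (2 * ((m : ℚ) + 3) - x - 3 - m))) := by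
    rw [hFN, mul_assoc]; unfold bp; rw [← mul_div_assoc, mul_div_cancel_left₀ _ hf3, fallProd_three]; ring
  have gp : FN m * bp (m + 3) (2 * ((m : ℚ) + 3) - x + 1) = (((m : ℚ) + 4) * ((2 * ((m : ℚ) + 3) - x + 1) * (2 * ((m : ℚ) + 3) - x) * fallProd m (2 * ((m : ℚ) + 3) - x - 1) * (2 * ((m : ℚ) + 3) - x - 1 - m))) := by
    rw [hFN, mul_assoc]; unfold bp; rw [← mul_div_assoc, mul_div_cancel_left₀ _ hf3, fallProd_three_succ]
  -- the kernel-checked endpoint polynomial identity, in ordinary form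
  have hend : ((-2*(((m + 3 : ℕ)) : ℚ) + x)^3*(-2*(((m + 3 : ℕ)) : ℚ) + x - 2)^2*(-2*(((m + 3 : ℕ)) : ℚ) + x - 1)^2*(-(((m + 3 : ℕ)) :
      ℚ) + x - 2)^2*(-(((m + 3 : ℕ)) : ℚ) + x - 1)*(2*(((m + 3 : ℕ)) : ℚ)^4 - (((m + 3 : ℕ)) : ℚ)^3*x + 13*(((m + 3 :
      ℕ)) : ℚ)^3 - 7*(((m + 3 : ℕ)) : ℚ)^2*x + 30*(((m + 3 : ℕ)) : ℚ)^2 + (((m + 3 : ℕ)) : ℚ)*x^2 - 11*(((m + 3 : ℕ)) :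
      ℚ)*x + 28*(((m + 3 : ℕ)) : ℚ) - 3*x + 8)) * e10 (((m + 3 : ℕ)) : ℚ) x + ((-2*(((m + 3 : ℕ)) : ℚ) + x)^3*((((m + 3
      : ℕ)) : ℚ) + 1)^2*(-(((m + 3 : ℕ)) : ℚ) + x - 2)^4*(-(((m + 3 : ℕ)) : ℚ) + x - 1)^3) * e00 (((m + 3 : ℕ)) : ℚ) x +
      ((-2*(((m + 3 : ℕ)) : ℚ) + x)*(-(((m + 3 : ℕ)) : ℚ) + x)^2*((((m + 3 : ℕ)) : ℚ) + 1)^2*(-(((m + 3 : ℕ)) : ℚ) + x -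
      2)^4*(-(((m + 3 : ℕ)) : ℚ) + x - 1)^3) * e01 (((m + 3 : ℕ)) : ℚ) x + ((((m + 3 : ℕ)) : ℚ)*(-2*(((m + 3 : ℕ)) : ℚ)
      + x)^2*((((m + 3 : ℕ)) : ℚ) + 1)^2*(-(((m + 3 : ℕ)) : ℚ) + x - 2)^2*(-(((m + 3 : ℕ)) : ℚ) + x - 1)^2) * PR0 (((m +
      3 : ℕ)) : ℚ) x (((m + 3 : ℕ)) : ℚ) + ((((m + 3 : ℕ)) : ℚ)*(-2*(((m + 3 : ℕ)) : ℚ) + x)^2*((((m + 3 : ℕ)) : ℚ) +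
      1)^2*(-2*(((m + 3 : ℕ)) : ℚ) + x - 1)*(-(((m + 3 : ℕ)) : ℚ) + x - 2)^2*(-(((m + 3 : ℕ)) : ℚ) + x - 1)) * PR1 (((m
      + 3 : ℕ)) : ℚ) x (((m + 3 : ℕ)) : ℚ)
      = 0 := by
    have h := endpoly ((m + 3 : ℕ) : ℚ) x
    rw [bEnd_E10, bEnd_E00, bEnd_E01, bEnd_P0, bEnd_P1] at h
    exact h
  rw [hs1, hs2, hs0, hs01]
  have hM : FN m ^ 2 * ((2 * ((m : ℚ) + 3) - x) * (2 * ((m : ℚ) + 3) - x - m - 1) ^ 2 * (2 * ((m : ℚ) + 3) - x - m - 2)) ≠ 0 :=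
    mul_ne_zero (pow_ne_zero 2 hF) (mul_ne_zero (mul_ne_zero nA (pow_ne_zero 2 nA1)) nA2)
  have key : FN m ^ 2 * ((2 * ((m : ℚ) + 3) - x) * (2 * ((m : ℚ) + 3) - x - m - 1) ^ 2 * (2 * ((m : ℚ) + 3) - x - m - 2))
      * (e10 (((m + 3 : ℕ)) : ℚ) x * (((-1 : ℚ) ^ (m + 3)) * ((m : ℚ) + 4) * bp (m + 4) (2 * ((m : ℚ) + 3) - x + 3) * (((((m + 4
        : ℕ)) : ℚ) + 1) * bp (m + 4) (2 * ((m : ℚ) + 3) - x + 3) - (((m + 4 : ℕ)) : ℚ) * bp (m + 4) (2 * ((m : ℚ) + 3) -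
        x + 2)) + -((-1 : ℚ) ^ (m + 3)) * bp (m + 4) (2 * ((m : ℚ) + 3) - x + 2) * bp (m + 4) (2 * ((m : ℚ) + 3) - x +
        2)) + e00 (((m + 3 : ℕ)) : ℚ) x * (((-1 : ℚ) ^ (m + 3)) * bp (m + 3) (2 * ((m : ℚ) + 3) - x) * bp (m + 3) (2 *
        ((m : ℚ) + 3) - x)) + e01 (((m + 3 : ℕ)) : ℚ) x * (((-1 : ℚ) ^ (m + 3)) * bp (m + 3) (2 * ((m : ℚ) + 3) - x - 1)
        * bp (m + 3) (2 * ((m : ℚ) + 3) - x - 1)) + gNK (m + 3) x (m + 3)) = 0 := by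
    push_cast at g3 g2 ga gm gp hg hend ⊢
    linear_combination (FN m ^ 2) * hg
      + ((2 * ((m : ℚ) + 3) - x) * (2 * ((m : ℚ) + 3) - x - m - 1) ^ 2 * (2 * ((m : ℚ) + 3) - x - m - 2) * e10 ((m : ℚ) + 3) x * ((-1 : ℚ) ^ (m + 3)) * ((m :
        ℚ) + 4) * (((m : ℚ) + 5) * ((FN m * bp (m + 4) (2 * ((m : ℚ) + 3) - x + 3)) + ((2 * ((m : ℚ) + 3) - x + 3) * (2 * ((m : ℚ) + 3) - x + 2) * (2
        * ((m : ℚ) + 3) - x + 1) * (2 * ((m : ℚ) + 3) - x) * fallProd m (2 * ((m : ℚ) + 3) - x - 1))) - ((m : ℚ) + 4) * (FN m * bp (m + 4) (2 * ((m :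
        ℚ) + 3) - x + 2)))) * g3
      + ((2 * ((m : ℚ) + 3) - x) * (2 * ((m : ℚ) + 3) - x - m - 1) ^ 2 * (2 * ((m : ℚ) + 3) - x - m - 2) * e10 ((m : ℚ) + 3) x * ((-1 : ℚ) ^ (m + 3)) * (-((m
        : ℚ) + 4) ^ 2 * ((2 * ((m : ℚ) + 3) - x + 3) * (2 * ((m : ℚ) + 3) - x + 2) * (2 * ((m : ℚ) + 3) - x + 1) * (2 * ((m : ℚ) + 3) - x) * fallProd
        m (2 * ((m : ℚ) + 3) - x - 1)) - ((FN m * bp (m + 4) (2 * ((m : ℚ) + 3) - x + 2)) + ((2 * ((m : ℚ) + 3) - x + 2) * (2 * ((m : ℚ) + 3) - x + 1)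
        * (2 * ((m : ℚ) + 3) - x) * fallProd m (2 * ((m : ℚ) + 3) - x - 1) * (2 * ((m : ℚ) + 3) - x - 1 - m))))) * g2
      + (((-1 : ℚ) ^ (m + 3)) * ((2 * ((m : ℚ) + 3) - x) * (2 * ((m : ℚ) + 3) - x - m - 1) ^ 2 * (2 * ((m : ℚ) + 3) - x - m - 2) * e00 ((m : ℚ) + 3) x * ((FN
        m * bp (m + 3) (2 * ((m : ℚ) + 3) - x)) + (((m : ℚ) + 4) * ((2 * ((m : ℚ) + 3) - x) * fallProd m (2 * ((m : ℚ) + 3) - x - 1) * (2 * ((m : ℚ) +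
        3) - x - 1 - m) * (2 * ((m : ℚ) + 3) - x - 2 - m)))) + ((m : ℚ) + 3) * (PR0 ((m : ℚ) + 3) x ((m : ℚ) + 3) * ((FN m * bp (m + 3) (2 * ((m : ℚ)
        + 3) - x)) + (((m : ℚ) + 4) * ((2 * ((m : ℚ) + 3) - x) * fallProd m (2 * ((m : ℚ) + 3) - x - 1) * (2 * ((m : ℚ) + 3) - x - 1 - m) * (2 * ((m :
        ℚ) + 3) - x - 2 - m)))) + PR1 ((m : ℚ) + 3) x ((m : ℚ) + 3) * (FN m * bp (m + 3) (2 * ((m : ℚ) + 3) - x + 1))))) * ga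
      + ((2 * ((m : ℚ) + 3) - x) * (2 * ((m : ℚ) + 3) - x - m - 1) ^ 2 * (2 * ((m : ℚ) + 3) - x - m - 2) * e01 ((m : ℚ) + 3) x * ((-1 : ℚ) ^ (m + 3)) * ((FN m
        * bp (m + 3) (2 * ((m : ℚ) + 3) - x - 1)) + (((m : ℚ) + 4) * (fallProd m (2 * ((m : ℚ) + 3) - x - 1) * (2 * ((m : ℚ) + 3) - x - 1 - m) * (2 *
        ((m : ℚ) + 3) - x - 2 - m) * (2 * ((m : ℚ) + 3) - x - 3 - m))))) * gm
      + (((-1 : ℚ) ^ (m + 3)) * ((m : ℚ) + 3) * PR1 ((m : ℚ) + 3) x ((m : ℚ) + 3) * (((m : ℚ) + 4) * ((2 * ((m : ℚ) + 3) - x) * fallProd m (2 * ((m : ℚ) + 3)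
        - x - 1) * (2 * ((m : ℚ) + 3) - x - 1 - m) * (2 * ((m : ℚ) + 3) - x - 2 - m)))) * gp
      + (((-1 : ℚ) ^ (m + 3)) * (fallProd m (2 * ((m : ℚ) + 3) - x - 1)) ^ 2) * hend
  exact (mul_eq_zero.mp key).resolve_left hM

/-! ### The relation for `x < 0` -/

/-- **(R-NK) for `x < 0`** (`n ≥ 3`): `e10·R(n+1,x) + e00·R(n,x) + e01·R(n,x+1) = 0`. -/
theorem R_rel_NK_neg (n : ℕ) (hn : 3 ≤ n) (x : ℚ) (hx : x < 0) :
    e10 (n : ℚ) x * Rsum (n + 1) x + e00 (n : ℚ) x * Rsum n x + e01 (n : ℚ) x * Rsum n (x + 1) = 0 := by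
  obtain ⟨m, rfl⟩ : ∃ m, n = m + 3 := ⟨n - 3, by omega⟩
  have htel := telescope₃ (e10 ((m + 3 : ℕ) : ℚ) x) (e00 ((m + 3 : ℕ) : ℚ) x) (e01 ((m + 3 : ℕ) : ℚ) x)
    (sR (m + 3 + 1) x) (sR (m + 3) x) (sR (m + 3) (x + 1)) (gNK (m + 3) x) (m + 3)
    (fun k hk => NK_termwise m x k hx (by omega))
  have hend := NK_endpoint m x hx
  rw [gNK_zero, sub_zero] at htel
  unfold Rsum
  rw [show m + 3 + 1 + 1 = m + 3 + 2 from rfl, sum_range_succ, sum_range_succ, sum_range_succ (sR (m + 3) x),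
    sum_range_succ (sR (m + 3) (x + 1))]
  linear_combination htel + hend

/-! ### Polynomiality in `x` and the relation for every rational `x` -/

/-- `x ↦ peval e [a, x, b]` is a polynomial function (structural recursion on the syntax tree). -/
def polyRepPeval (a b : ℚ) : (e : Expr) → PolyRep (fun x => peval e [a, x, b])
  | .num c => ⟨Polynomial.C (c : ℚ), fun x => by rw [peval_num, eval_C]⟩
  | .natCast c => ⟨Polynomial.C (c : ℚ), fun x => by rw [peval_natCast, eval_C]⟩
  | .intCast c => ⟨Polynomial.C (c : ℚ), fun x => by rw [peval_intCast, eval_C]⟩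
  | .var 0 => ⟨Polynomial.C a, fun x => by rw [peval_var, eval_C]; rfl⟩
  | .var 1 => ⟨Polynomial.X, fun x => by rw [peval_var, eval_X]; rfl⟩
  | .var (i + 2) => ⟨Polynomial.C b, fun x => by
      rw [peval_var, eval_C]
      show (ctx [a, x, b]).get (i + 2) = b
      rfl⟩
  | .neg p => ⟨-(polyRepPeval a b p).poly, fun x => by rw [peval_neg, eval_neg, (polyRepPeval a b p).eval_eq x]⟩
  | .add p q => ⟨(polyRepPeval a b p).poly + (polyRepPeval a b q).poly, fun x => by
      rw [peval_add, eval_add, (polyRepPeval a b p).eval_eq x, (polyRepPeval a b q).eval_eq x]⟩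
  | .sub p q => ⟨(polyRepPeval a b p).poly - (polyRepPeval a b q).poly, fun x => by
      rw [peval_sub, eval_sub, (polyRepPeval a b p).eval_eq x, (polyRepPeval a b q).eval_eq x]⟩
  | .mul p q => ⟨(polyRepPeval a b p).poly * (polyRepPeval a b q).poly, fun x => by
      rw [peval_mul, eval_mul, (polyRepPeval a b p).eval_eq x, (polyRepPeval a b q).eval_eq x]⟩
  | .pow p j => ⟨(polyRepPeval a b p).poly ^ j, fun x => by rw [peval_pow, eval_pow, (polyRepPeval a b p).eval_eq x]⟩

/-- `x ↦ e10(n,x)` is polynomial. -/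
def polyRep_e10 (w : ℚ) : PolyRep fun x => e10 w x :=
  ⟨(polyRepPeval w 0 eE10).poly, fun x => by rw [← e10_peval w x 0]; exact (polyRepPeval w 0 eE10).eval_eq x⟩

/-- `x ↦ e00(n,x)` is polynomial. -/
def polyRep_e00 (w : ℚ) : PolyRep fun x => e00 w x :=
  ⟨(polyRepPeval w 0 eE00).poly, fun x => by rw [← e00_peval w x 0]; exact (polyRepPeval w 0 eE00).eval_eq x⟩

/-- `x ↦ e01(n,x)` is polynomial. -/
def polyRep_e01 (w : ℚ) : PolyRep fun x => e01 w x :=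
  ⟨(polyRepPeval w 0 eE01).poly, fun x => by rw [← e01_peval w x 0]; exact (polyRepPeval w 0 eE01).eval_eq x⟩

/-- The (R-NK) combination as a polynomially represented function of `x`. -/
def polyRep_NK (n : ℕ) :
    PolyRep fun x => e10 (n : ℚ) x * Rsum (n + 1) x + e00 (n : ℚ) x * Rsum n x + e01 (n : ℚ) x * Rsum n (x + 1) := by
  have h0 : PolyRep fun x => Rsum (n + 1) x := by
    have h := polyRep_Rsum (n + 1) 0
    exact ⟨h.poly, fun x => by rw [← add_zero x, h.eval_eq x, add_zero]⟩
  have h1 : PolyRep fun x => Rsum n x := by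
    have h := polyRep_Rsum n 0
    exact ⟨h.poly, fun x => by rw [← add_zero x, h.eval_eq x, add_zero]⟩
  exact (((polyRep_e10 n).mul h0).add ((polyRep_e00 n).mul h1)).add ((polyRep_e01 n).mul (polyRep_Rsum n 1))

/-- **(R-NK), replayed certificate**: for `n ≥ 3` and EVERY rational `x = k₃`,
`e10(n,x)·R(n+1,x) + e00(n,x)·R(n,x) + e01(n,x)·R(n,x+1) = 0`, where `e10 = (n+1)³(x−2n−2)²(x−2n−1)²`,
`e00 = 5η₀₀`, `e01 = 5η₀₁` are the ttrl2 lane's R-NK telescoper (`r1c/R_NK.json`, ×5) and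
`R(n,x) = Σ_{k ≤ n} (−1)^k C(n,k) C(3n−x−k, n)·T(n; 3n−x−k, 2n−k)` is the inner double sum of the brown9
"vanishing in the middle" leading coefficient (`Certificates/VIMLevel2K2.lean`). -/
theorem R_rel_NK (n : ℕ) (hn : 3 ≤ n) (x : ℚ) :
    e10 (n : ℚ) x * Rsum (n + 1) x + e00 (n : ℚ) x * Rsum n x + e01 (n : ℚ) x * Rsum n (x + 1) = 0 :=
  (polyRep_NK n).eq_zero_of_lt 0 (fun y hy => R_rel_NK_neg n hn y hy) x

end NK

end VIMInner

end Summit.KontsevichZagierPeriods.Zeta5Search.Certificates
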